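import Mathlib
import HarnessLib
import Summits.NavierStokesRegularity.NavierStokesRegularity.Theses.PoloidalWindowDoor
import Summits.NavierStokesRegularity.NavierStokesRegularity.Theorems.LocalSineTubeDoorLocalPointZoomSlices

/-!
# Route `PoloidalWindowDoor`, crux K1 `LocalPointZoomSlices` — CLOSED by the tree theorem
# `Theorems.LocalSineTubeDoorLocalPointZoomSlices.localPointZoomSlices` (nsreg-p6 g0, p419469)

Cell ns-regularity-ideate, seat p6. The all-slices local point zoom (item `LocalPointZoomSlices` of route
`PoloidalWindowDoor`) was landed VERBATIM as a theorem while the route was staged; this file records it BY NAME against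
the born Theses decl.

WHAT THIS IS NOT: not a claim about Navier–Stokes regularity; a blow-up/compactness lemma (local Type I, not backward
bounded ⇒ a Type-I Oseen-mild tangent flow with singular apex and slice-wise vorticity convergence).
-/

noncomputable section

-- the summit and its single sub-problem share the name (CONVENTIONS §1), as in every Theorems file
set_option linter.dupNamespace false

namespace Summit.NavierStokesRegularity.NavierStokesRegularity.Theorems.PoloidalWindowDoorLocalPointZoomSlices

open Summit.NavierStokesRegularity.NavierStokesRegularity.Theorems.LocalSineTubeDoorLocalPointZoomSlices

/-- **K1 `LocalPointZoomSlices` of route `PoloidalWindowDoor` is a THEOREM** (= `localPointZoomSlices`, p419469). -/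
theorem localPointZoomSlices_proof :
    Summit.NavierStokesRegularity.NavierStokesRegularity.Theses.PoloidalWindowDoor.LocalPointZoomSlices := by
  unfold Summit.NavierStokesRegularity.NavierStokesRegularity.Theses.PoloidalWindowDoor.LocalPointZoomSlices
  exact localPointZoomSlices

end Summit.NavierStokesRegularity.NavierStokesRegularity.Theorems.PoloidalWindowDoorLocalPointZoomSlices

end
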